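import Literature.AlgebraicGeometry.Morphisms.FormalModuleCompletion
import Literature.AlgebraicGeometry.Modules.IdealMul
import Literature.AlgebraicGeometry.Morphisms.FormalModulePowerTorsion
import HarnessLib

/-!
# Annihilator bookkeeping for kernels and cokernels: composites and maps induced on `M/aⁿ⁺¹M`

Görtz–Wedhorn, *Algebraic Geometry II* (2023), proof of Lemma 24.105 (p. 574: "Then `𝒜 := ℐℐ'`
annihilates `𝒦` and `𝒞` and a fortiori all `𝒦_n` and `𝒞_n`") and Construction 24.104 (3); The
Stacks Project, Tag 088B (the levelwise kernels and cokernels of a composite of a map with an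
`a`-power isogeny). In the tree's language of sheaves of `𝒪_X`-modules KILLED by an ideal sheaf
(`Modules/Torsion.IsKilledBy`) and of multiplication by a global function
(`Modules/LinearOverBase.globalScalar`), this file records the elementary transfers used when the
unit of a Chow cover is composed with the comparison of the theorem on formal functions and reduced
modulo `aⁿ⁺¹`:

* `exists_local_preimage_of_cokernel_π_app_eq_zero` — a section of `B` dying in `coker v` is locally
  in the image of `v : A → B` (`im v = ker (coker v)`, epimorphisms are locally surjective);
* `isKilledBy_mul_kernel_comp`, `isKilledBy_mul_cokernel_comp` — **composites**: if `ker f` is killed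
  by `𝒥` and `ker g` by `bᶜ` then `ker (f ≫ g)` is killed by `(b)ᶜ·𝒥`; if `coker f` is killed by `𝒥'`
  and `coker g` by `bᶜ` then `coker (f ≫ g)` is killed by `(b)ᶜ·𝒥'`;
* `isKilledBy_mul_kernel_cmplMapApp`, `isKilledBy_cokernel_cmplMapApp` — **reduction modulo
  `aⁿ⁺¹`**: if `ker θ` is killed by `ℐ` and `coker θ` by `ℐ'`, then the map
  `θ̄_n : M/aⁿ⁺¹M → N/aⁿ⁺¹N` (`Morphisms/FormalModuleCompletion.cmplMapApp`) has kernel killed by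
  `ℐ·ℐ'` and cokernel killed by `ℐ'` ("a fortiori all `𝒦_n` and `𝒞_n`").

Everything is proved; no named facts; no definitions.

## References

* U. Görtz, T. Wedhorn, *Algebraic Geometry II: Cohomology of Schemes*, Springer Spektrum (2023),
  doi:10.1007/978-3-658-43031-3: Construction 24.104 (3), Lemma 24.105 and its proof (pp. 573–574).
  [GortzWedhorn2023]
* The Stacks Project, Tag 088B (Lemma 30.27.2), Tag 088C. [StacksProject]
-/

noncomputable section

-- `TopCat.Presheaf`/`Scheme.Modules` are not reducible (as in Mathlib's `AlgebraicGeometry/Modules`).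
set_option backward.isDefEq.respectTransparency false

open CategoryTheory CategoryTheory.Limits AlgebraicGeometry TopologicalSpace Opposite
open Literature.AlgebraicGeometry.Motives Literature.AlgebraicGeometry.Morphisms

universe u

namespace Literature.AlgebraicGeometry.Modules

variable {X : Scheme.{u}} (b : Γ(X, ⊤))

/-- The ideal of the affine open `V` attached to `(b)ᶜ` is generated by `bᶜ|_V`. [folklore] -/
private theorem ideal_pow_ofIdealTop_span₀ (c : ℕ) (V : X.affineOpens) :
    (Scheme.IdealSheafData.ofIdealTop (Ideal.span {b}) ^ c).ideal V =
      Ideal.span {X.presheaf.map (homOfLE (le_top : (V : X.Opens) ≤ ⊤)).op (b ^ c)} := by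
  rw [Scheme.IdealSheafData.ideal_pow, Pi.pow_apply, Scheme.IdealSheafData.ofIdealTop_ideal,
    Ideal.map_span, Set.image_singleton, Ideal.span_singleton_pow, map_pow]

/-! ### Local preimages through the image -/

/-- **A section of `B` which dies in `coker v` is locally in the image of `v : A → B`**: the kernel
of `B → coker v` is the image of `v`, onto which `A` maps by an epimorphism, and epimorphisms of
sheaves of modules are locally surjective. [cite: StacksProject, Tag 088B] -/
theorem exists_local_preimage_of_cokernel_π_app_eq_zero {A B : X.Modules} (v : A ⟶ B) (U : X.Opens)
    (t : Γ(B, U)) (ht : (cokernel.π v).app U t = 0) (x : X) (hx : x ∈ U) :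
    ∃ (W : X.Opens) (hW : W ≤ U), x ∈ W ∧ ∃ s : Γ(A, W),
      v.app W s = B.presheaf.map (homOfLE hW).op t := by
  obtain ⟨w, hw⟩ := exists_kernel_ι_app_eq (cokernel.π v) U _ ht
  obtain ⟨W, hW, hxW, s, hs⟩ :=
    Scheme.Modules.exists_app_eq_of_epi (Abelian.factorThruImage v) U w x hx
  refine ⟨W, hW, hxW, s, ?_⟩
  have hfac : v.app W s = (Abelian.image.ι v).app W ((Abelian.factorThruImage v).app W s) := by
    conv_lhs => rw [← Abelian.image.fac v]
    rfl
  have hw' : (Abelian.image.ι v).app U w = t := hw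
  rw [hfac, hs, Scheme.Modules.Hom.app_map_apply, hw']

/-- The same around every point of an affine open, with the neighbourhood shrunk to an AFFINE open.
[cite: StacksProject, Tag 088B] -/
theorem exists_affine_local_preimage_of_cokernel_π_app_eq_zero {A B : X.Modules} (v : A ⟶ B)
    (U : X.Opens) (t : Γ(B, U)) (ht : (cokernel.π v).app U t = 0) (x : X) (hx : x ∈ U) :
    ∃ (W : X.Opens) (hW : W ≤ U), IsAffineOpen W ∧ x ∈ W ∧ ∃ s : Γ(A, W),
      v.app W s = B.presheaf.map (homOfLE hW).op t := by
  obtain ⟨W, hWU, hxW, s, hs⟩ := exists_local_preimage_of_cokernel_π_app_eq_zero v U t ht x hx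
  obtain ⟨W', hW', hxW', hW'le⟩ := Opens.isBasis_iff_nbhd.mp X.isBasis_affineOpens hxW
  refine ⟨W', hW'le.trans hWU, hW', hxW', A.presheaf.map (homOfLE hW'le).op s, ?_⟩
  rw [Scheme.Modules.Hom.app_map_apply, hs, map_map]
  exact map_eq_map _ _ _ _

/-! ### Composites -/

/-- **Kernel of a composite.** If `ker f` is killed by the ideal sheaf `𝒥` and `ker g` by `bᶜ`, then
`ker (f ≫ g)` is killed by `(b)ᶜ·𝒥`: a section `x` with `g(f(x)) = 0` has `bᶜ f(x) = f(bᶜ x) = 0`,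
so `bᶜ x ∈ ker f` is killed by `𝒥`. [cite: GortzWedhorn2023, Lemma 24.105 (proof, p. 574)] -/
theorem isKilledBy_mul_kernel_comp {M N P : X.Modules} (f : M ⟶ N) (g : N ⟶ P) {J : X.IdealSheafData}
    (hf : IsKilledBy J (kernel f)) {c : ℕ} (hg : kernel.ι g ≫ globalScalar N (b ^ c) = 0) :
    IsKilledBy (Scheme.IdealSheafData.ofIdealTop (Ideal.span {b}) ^ c * J) (kernel (f ≫ g)) := by
  intro V r hr k
  rw [Scheme.IdealSheafData.ideal_mul, Pi.mul_apply] at hr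
  refine Submodule.mul_induction_on hr (fun m hm t ht => ?_) (fun x y hx hy => ?_)
  · rw [ideal_pow_ofIdealTop_span₀, Ideal.mem_span_singleton'] at hm
    obtain ⟨s, rfl⟩ := hm
    apply kernel_ι_app_injective (f ≫ g) (V : X.Opens)
    rw [Scheme.Modules.Hom.app_smul, map_zero]
    set x : Γ(M, V) := (kernel.ι (f ≫ g)).app (V : X.Opens) k with hx
    -- `f x` is a section of `ker g`, hence killed by `bᶜ`
    have hgfx : g.app (V : X.Opens) (f.app (V : X.Opens) x) = 0 := by
      rw [← CategoryTheory.comp_apply, ← Scheme.Modules.Hom.comp_app]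
      exact app_kernel_ι_app (f ≫ g) V k
    obtain ⟨k', hk'⟩ := exists_kernel_ι_app_eq g (V : X.Opens) _ hgfx
    have hbfx : X.presheaf.map (homOfLE (le_top : (V : X.Opens) ≤ ⊤)).op (b ^ c) •
        f.app (V : X.Opens) x = 0 := by
      rw [← hk', ← globalScalar_app_apply]
      have h := congrArg (fun φ => φ.app (V : X.Opens) k') hg
      simpa [Scheme.Modules.Hom.zero_app] using h
    -- so `bᶜ x ∈ ker f`, killed by `𝒥`
    have hfbx : f.app (V : X.Opens)
        (X.presheaf.map (homOfLE (le_top : (V : X.Opens) ≤ ⊤)).op (b ^ c) • x) = 0 := by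
      rw [Scheme.Modules.Hom.app_smul, hbfx]
    obtain ⟨k'', hk''⟩ := exists_kernel_ι_app_eq f (V : X.Opens) _ hfbx
    have ht0 : t • (X.presheaf.map (homOfLE (le_top : (V : X.Opens) ≤ ⊤)).op (b ^ c) • x) = 0 := by
      rw [← hk'', ← Scheme.Modules.Hom.app_smul, hf V t ht k'', map_zero]
    rw [show s * X.presheaf.map (homOfLE (le_top : (V : X.Opens) ≤ ⊤)).op (b ^ c) * t =
        s * (t * X.presheaf.map (homOfLE (le_top : (V : X.Opens) ≤ ⊤)).op (b ^ c)) by ring,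
      mul_smul, mul_smul, ht0, smul_zero]
  · rw [add_smul, hx, hy, add_zero]

/-- **Cokernel of a composite.** If `coker f` is killed by the ideal sheaf `𝒥'` and `coker g` by `bᶜ`,
then `coker (f ≫ g)` is killed by `(b)ᶜ·𝒥'`: with `ḡ : coker f → coker (f ≫ g)` induced by `g`,
`coker ḡ` is a quotient of `coker g`, so `bᶜ` times a section of `coker (f ≫ g)` is locally `ḡ(u)`,
and `t • ḡ(u) = ḡ(t • u) = 0` for `t ∈ 𝒥'`. [cite: GortzWedhorn2023, Lemma 24.105 (proof, p. 574)] -/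
theorem isKilledBy_mul_cokernel_comp {M N P : X.Modules} (f : M ⟶ N) (g : N ⟶ P)
    {J' : X.IdealSheafData} (hf : IsKilledBy J' (cokernel f)) {c : ℕ}
    (hg : globalScalar P (b ^ c) ≫ cokernel.π g = 0) :
    IsKilledBy (Scheme.IdealSheafData.ofIdealTop (Ideal.span {b}) ^ c * J') (cokernel (f ≫ g)) := by
  -- `ḡ : coker f → coker (f ≫ g)` and `coker ḡ`, a quotient of `coker g`, killed by `bᶜ`
  let gbar : cokernel f ⟶ cokernel (f ≫ g) :=
    cokernel.desc f (g ≫ cokernel.π (f ≫ g)) (by rw [← Category.assoc]; exact cokernel.condition _)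
  have hgbar : cokernel.π f ≫ gbar = g ≫ cokernel.π (f ≫ g) := cokernel.π_desc _ _ _
  let e : cokernel g ⟶ cokernel gbar :=
    cokernel.desc g (cokernel.π (f ≫ g) ≫ cokernel.π gbar)
      (by rw [← Category.assoc, ← hgbar, Category.assoc, cokernel.condition, comp_zero])
  have he : cokernel.π g ≫ e = cokernel.π (f ≫ g) ≫ cokernel.π gbar := cokernel.π_desc _ _ _
  haveI : Epi e := epi_of_epi_fac he
  have hcg : globalScalar (cokernel g) (b ^ c) = 0 := by
    rw [← cancel_epi (cokernel.π g), ← globalScalar_comp, hg, comp_zero]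
  have hcgbar : IsKilledBy (Scheme.IdealSheafData.ofIdealTop (Ideal.span {b}) ^ c) (cokernel gbar) :=
    IsKilledBy.of_epi e (isKilledBy_pow_ofIdealTop_of_globalScalar_eq_zero b hcg)
  intro V r hr y
  rw [Scheme.IdealSheafData.ideal_mul, Pi.mul_apply] at hr
  refine Submodule.mul_induction_on hr (fun m hm t ht => ?_) (fun x y' hx hy => ?_)
  · have hm' := hm
    rw [ideal_pow_ofIdealTop_span₀, Ideal.mem_span_singleton'] at hm'
    obtain ⟨s, rfl⟩ := hm'
    -- `bᶜ • y` dies in `coker ḡ`, hence is locally `ḡ u`; then `t • bᶜ • y = ḡ (t • u) = 0` locally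
    have hBy : (cokernel.π gbar).app (V : X.Opens)
        (X.presheaf.map (homOfLE (le_top : (V : X.Opens) ≤ ⊤)).op (b ^ c) • y) = 0 := by
      rw [Scheme.Modules.Hom.app_smul]
      exact hcgbar V _ (by rw [ideal_pow_ofIdealTop_span₀]; exact Ideal.mem_span_singleton_self _) _
    have ht0 : t • (X.presheaf.map (homOfLE (le_top : (V : X.Opens) ≤ ⊤)).op (b ^ c) • y) = 0 := by
      refine section_eq_zero_of_locally (cokernel (f ≫ g)) _ fun x hx => ?_
      obtain ⟨W, hW, hWaff, hxW, u, hu⟩ :=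
        exists_affine_local_preimage_of_cokernel_π_app_eq_zero gbar V _ hBy x hx
      refine ⟨W, hW, hxW, ?_⟩
      have hle : (⟨W, hWaff⟩ : X.affineOpens) ≤ V := hW
      rw [Scheme.Modules.map_smul, ← hu, ← Scheme.Modules.Hom.app_smul]
      exact (congrArg (gbar.app W) (hf ⟨W, hWaff⟩ _ (J'.ideal_le_comap_ideal hle ht) u)).trans
        (map_zero _)
    rw [show s * X.presheaf.map (homOfLE (le_top : (V : X.Opens) ≤ ⊤)).op (b ^ c) * t =
        s * (t * X.presheaf.map (homOfLE (le_top : (V : X.Opens) ≤ ⊤)).op (b ^ c)) by ring,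
      mul_smul, mul_smul, ht0, smul_zero]
  · rw [add_smul, hx, hy, add_zero]

/-! ### Reduction modulo `aⁿ⁺¹` -/

section Cmpl

variable (a : Γ(X, ⊤)) {M N : X.Modules} (θ : M ⟶ N) (n : ℕ)

/-- The canonical epimorphism `coker θ → coker θ̄_n` (`θ̄_n : M/aⁿ⁺¹M → N/aⁿ⁺¹N`). [folklore] -/
private theorem exists_epi_cokernel_to_cokernel_cmplMapApp :
    ∃ e : cokernel θ ⟶ cokernel (cmplMapApp a θ n),
      cokernel.π θ ≫ e = cmplπ a N n ≫ cokernel.π (cmplMapApp a θ n) := by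
  refine ⟨cokernel.desc θ (cmplπ a N n ≫ cokernel.π (cmplMapApp a θ n)) ?_, cokernel.π_desc _ _ _⟩
  rw [← Category.assoc, ← cmplπ_cmplMapApp, Category.assoc, cokernel.condition, comp_zero]

/-- **Cokernel of `θ̄_n : M/aⁿ⁺¹M → N/aⁿ⁺¹N`**: a quotient of `coker θ`, hence killed by whatever
kills `coker θ` ("a fortiori all `𝒞_n`"). [cite: GortzWedhorn2023, Lemma 24.105 (proof, p. 574)] -/
theorem isKilledBy_cokernel_cmplMapApp {I : X.IdealSheafData} (hc : IsKilledBy I (cokernel θ)) :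
    IsKilledBy I (cokernel (cmplMapApp a θ n)) := by
  obtain ⟨e, he⟩ := exists_epi_cokernel_to_cokernel_cmplMapApp a θ n
  haveI : Epi (cmplπ a N n ≫ cokernel.π (cmplMapApp a θ n)) := epi_comp _ _
  haveI : Epi e := epi_of_epi_fac he
  exact IsKilledBy.of_epi e hc

/-- `M → M/aⁿ⁺¹M` kills `aⁿ⁺¹ • m`. [folklore] -/
private theorem cmplπ_app_pow_smul (U : X.Opens) (m : Γ(M, U)) :
    (cmplπ a M n).app U (X.presheaf.map (homOfLE (le_top : U ≤ ⊤)).op (a ^ (n + 1)) • m) = 0 := by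
  rw [← globalScalar_app_apply, ← CategoryTheory.comp_apply, ← Scheme.Modules.Hom.comp_app]
  change (globalScalar M (a ^ (n + 1)) ≫ cokernel.π (globalScalar M (a ^ (n + 1)))).app U m = 0
  rw [cokernel.condition, Scheme.Modules.Hom.zero_app]
  rfl

/-- **Kernel of `θ̄_n : M/aⁿ⁺¹M → N/aⁿ⁺¹N`**: if `ker θ` is killed by `ℐ` and `coker θ` by `ℐ'`, then
`ker θ̄_n` is killed by `ℐ·ℐ'` ("a fortiori all `𝒦_n`"): for a section `x` of `M` with
`θ x = aⁿ⁺¹ y`, and `t ∈ ℐ'`, locally `t y = θ z`, so `θ (t x - aⁿ⁺¹ z) = 0` and `s t x ≡ 0 mod aⁿ⁺¹`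
for `s ∈ ℐ`. [cite: GortzWedhorn2023, Lemma 24.105 (proof, p. 574)] -/
theorem isKilledBy_mul_kernel_cmplMapApp {I I' : X.IdealSheafData} (hk : IsKilledBy I (kernel θ))
    (hc : IsKilledBy I' (cokernel θ)) :
    IsKilledBy (I * I') (kernel (cmplMapApp a θ n)) := by
  intro V r hr k
  rw [Scheme.IdealSheafData.ideal_mul, Pi.mul_apply] at hr
  refine Submodule.mul_induction_on hr (fun s hs t ht => ?_) (fun x y hx hy => ?_)
  · apply kernel_ι_app_injective (cmplMapApp a θ n) (V : X.Opens)
    rw [Scheme.Modules.Hom.app_smul, map_zero]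
    obtain ⟨xb, hxb⟩ : ∃ xb : Γ(cmplObj a M n, V), (kernel.ι (cmplMapApp a θ n)).app (V : X.Opens) k = xb :=
      ⟨_, rfl⟩
    have hθxb : (cmplMapApp a θ n).app (V : X.Opens) xb = 0 := by
      rw [← hxb]; exact app_kernel_ι_app (cmplMapApp a θ n) (V : X.Opens) k
    rw [hxb]
    refine section_eq_zero_of_locally (cmplObj a M n) _ fun x hx => ?_
    -- lift `x̄` locally to a section `x₁` of `M`
    obtain ⟨W₁, hW₁V, hxW₁, x₁, hx₁⟩ := Scheme.Modules.exists_app_eq_of_epi (cmplπ a M n) V xb x hx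
    -- `θ x₁` dies in `N/aⁿ⁺¹N`, hence locally `θ x₁ = aⁿ⁺¹ • y`
    have hθx₁ : (cokernel.π (globalScalar N (a ^ (n + 1)))).app W₁ (θ.app W₁ x₁) = 0 := by
      change (cmplπ a N n).app W₁ (θ.app W₁ x₁) = 0
      rw [← CategoryTheory.comp_apply, ← Scheme.Modules.Hom.comp_app, ← cmplπ_cmplMapApp,
        Scheme.Modules.Hom.comp_app, CategoryTheory.comp_apply, hx₁, Scheme.Modules.Hom.app_map_apply,
        hθxb, map_zero]
    obtain ⟨W₂, hW₂, hW₂aff, hxW₂, y, hy⟩ :=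
      exists_affine_local_preimage_of_cokernel_π_app_eq_zero _ W₁ _ hθx₁ x hxW₁
    -- `t • y` dies in `coker θ`, hence locally `θ z = t • y`
    have hle₂ : (⟨W₂, hW₂aff⟩ : X.affineOpens) ≤ V := hW₂.trans hW₁V
    have hty : (cokernel.π θ).app W₂ (X.presheaf.map (homOfLE (hW₂.trans hW₁V)).op t • y) = 0 := by
      rw [Scheme.Modules.Hom.app_smul]
      exact hc ⟨W₂, hW₂aff⟩ _ (I'.ideal_le_comap_ideal hle₂ ht) _
    obtain ⟨W₃, hW₃, hW₃aff, hxW₃, z, hz⟩ :=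
      exists_affine_local_preimage_of_cokernel_π_app_eq_zero θ W₂ _ hty x hxW₂
    have hle₃ : (⟨W₃, hW₃aff⟩ : X.affineOpens) ≤ V := hW₃.trans (hW₂.trans hW₁V)
    -- `u := t x₁ - aⁿ⁺¹ z` on `W₃` is killed by `θ`
    obtain ⟨x₃, hx₃⟩ : ∃ x₃ : Γ(M, W₃), x₃ = M.presheaf.map (homOfLE (hW₃.trans hW₂)).op x₁ :=
      ⟨_, rfl⟩
    obtain ⟨u, hu⟩ : ∃ u : Γ(M, W₃), u =
        X.presheaf.map (homOfLE (hW₃.trans (hW₂.trans hW₁V))).op t • x₃ -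
          X.presheaf.map (homOfLE (le_top : W₃ ≤ ⊤)).op (a ^ (n + 1)) • z := ⟨_, rfl⟩
    have hθu : θ.app W₃ u = 0 := by
      have h1 : θ.app W₃ x₃ = N.presheaf.map (homOfLE (hW₃.trans hW₂)).op (θ.app W₁ x₁) := by
        rw [hx₃, Scheme.Modules.Hom.app_map_apply]
      have h2 : N.presheaf.map (homOfLE hW₂).op (θ.app W₁ x₁) =
          X.presheaf.map (homOfLE (le_top : W₂ ≤ ⊤)).op (a ^ (n + 1)) • y := by
        rw [← hy, globalScalar_app_apply]
      rw [hu, map_sub, Scheme.Modules.Hom.app_smul, Scheme.Modules.Hom.app_smul, h1, hz,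
        map_eq_map N _ ((homOfLE hW₂).op ≫ (homOfLE hW₃).op), ← map_map, h2,
        Scheme.Modules.map_smul, Scheme.Modules.map_smul, smul_smul, smul_smul, sub_eq_zero]
      congr 1
      rw [mul_comm]
      congr 1 <;> (rw [← CategoryTheory.comp_apply, ← Functor.map_comp]; rfl)
    obtain ⟨k₃, hk₃⟩ := exists_kernel_ι_app_eq θ W₃ u hθu
    -- hence `s • u = 0`
    have hsu : X.presheaf.map (homOfLE (hW₃.trans (hW₂.trans hW₁V))).op s • u = 0 := by
      rw [← hk₃, ← Scheme.Modules.Hom.app_smul]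
      exact (congrArg ((kernel.ι θ).app W₃)
        (hk ⟨W₃, hW₃aff⟩ _ (I.ideal_le_comap_ideal hle₃ hs) k₃)).trans (map_zero _)
    refine ⟨W₃, hW₃.trans (hW₂.trans hW₁V), hxW₃, ?_⟩
    -- restrict `(s t) • x̄` to `W₃` and compute through `x₁`
    rw [Scheme.Modules.map_smul, map_eq_map (cmplObj a M n) _ ((homOfLE hW₁V).op ≫
        (homOfLE (hW₃.trans hW₂)).op), ← map_map, ← hx₁, ← Scheme.Modules.Hom.app_map_apply, ← hx₃]
    -- `(s t) • π(x₃) = π(s • (t • x₃)) = π(s • u + s aⁿ⁺¹ z) = π (aⁿ⁺¹ • (s • z))`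
    have hst : X.presheaf.map (homOfLE (hW₃.trans (hW₂.trans hW₁V))).op (s * t) • x₃ =
        X.presheaf.map (homOfLE (hW₃.trans (hW₂.trans hW₁V))).op s • u +
          X.presheaf.map (homOfLE (le_top : W₃ ≤ ⊤)).op (a ^ (n + 1)) •
            (X.presheaf.map (homOfLE (hW₃.trans (hW₂.trans hW₁V))).op s • z) := by
      rw [hu, smul_sub, map_mul, mul_smul, smul_smul _ _ z, smul_smul _ _ z, mul_comm, sub_add_cancel]
    rw [← Scheme.Modules.Hom.app_smul, hst, hsu, zero_add, cmplπ_app_pow_smul]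
  · rw [add_smul, hx, hy, add_zero]

end Cmpl

end Literature.AlgebraicGeometry.Modules

end
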